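import Summits.QuantumFields.YangMills.Theorems.BalabanLadderUVSeamRecColdWallKernelMeanPolyWindowCrux
import Summits.QuantumFields.YangMills.Theorems.BalabanLadderUVSeamRecClassicalResponseDirichlet
import Summits.QuantumFields.YangMills.Theorems.BalabanLadderUVSeamRecClassicalResponseSemiclassical
import HarnessLib

/-!
# Crux `UVSeamRec` (stmt-QuantumFields-20043), line «coldwall_pure»: THE DIRICHLET RATE LAW (DR) HOLDS ON THE POLYNOMIAL WINDOW —
# `R⁴ · |kerE^𝟙_{β,(x−R−1,2R+3)}(plane q x) − p(q, β)| ≤ A₀` for ALL `1 ≤ R ≤ ⌈β^{1/100}⌉ − 1`, with `p(q, β) = 2 − (3/2)·V_∞(q)/β`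

Helper file (`--supports stmt-QuantumFields-20043`) of the LEAD seat `ym-spine-20043-p1` (gen 14); sequel of `…ColdWallKernelMeanPolyWindowCrux`.
The registered stub `stub_dirichletRate : ClassicalResponse.DirichletRateSU2` of `Lines/coldwall_pure.lean` (the lineage's INSTRUMENT ROW) posits
`∃ C₁ A₀ P₀ β₁ ℓ₁ p, …, ∀ β ≥ β₁, ∀ R ≥ 1 with R·uRec β ≤ ℓ₁, ∀ q x: (R⁴/C₁)|kerE^𝟙_{β,(x−R−1,2R+3)}(plane q x) − p q β| ≤ A₀` — the cold-wall
centre-plane mean converges in the box size at RATE `R⁻⁴` to a bounded `β`-dependent reference, uniformly on the FEMTO window `R ≤ ℓ₁/uRec β`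
(exponentially large boxes).  THIS FILE PROVES THE SAME SENTENCE WITH THE FEMTO WINDOW REPLACED BY THE POLYNOMIAL WINDOW `R + 1 ≤ ⌈β^θ⌉`
(`0 < θ ≤ 1/100`), with the EXPLICIT reference `p q β = 2 − (3/2)·V_∞(q)/max β 1`, `V_∞(q) = (d₁ div₂ g_{(0;q)})(0;q)` the coincident value of
the `ℤ⁴` lattice-Maxwell curvature kernel (`curl_greenTensor_self`: base-point free):
* **`dirichletRate_polyWindow`** (§2) — `∃ A₀ P₀ β₁, (∀ q β, |p q β| ≤ P₀) ∧ ∀ β ≥ β₁, ∀ R, 1 ≤ R → R + 1 ≤ ⌈β^θ⌉ → ∀ q x, q.1 < q.2 →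
  R⁴ · |kerE^𝟙_{β,(x−R−1,2R+3)}(plane q x) − p q β| ≤ A₀` (`C₁ = 1`).
* §3 `tendsto_rpow_mul_uRec` (`β^a·uRec β → 0`), `eventually_ceil_rpow_mul_uRec_le`, and **`dirichletRateSU2_of_femtoTail`**: `DirichletRateSU2`
  FOLLOWS from its own sentence restricted to the TAIL window `⌈β^θ⌉ ≤ R + 2 ∧ R·uRec β ≤ ℓ₁` (one scale of overlap; references glued at the junction
  `R* = ⌈β^θ⌉ − 1`) — the registered stub `stub_dirichletRate` is thereby REDUCIBLE to `stub_dirichletRateFemtoTail` (the LEAD's reshape of the line).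
Ingredients: `kerE_one_deficit_semiclassical_polyWindow` (the kernel mean is `(3/2)·C_{D,R+1}/β ± β^{−1−θ}`, from the route `WeakCouplingRates`'
one-scale expansion at the flat datum), the route's Dirichlet-vs-`ℤ⁴` law of the curvature kernel `exists_boxDirProjKernel_sub_curl_bound`
(`|C_{D,H}(centre) − V_∞| ≤ K/H⁴`, `H ≥ 32`; smaller boxes are absorbed in the constant since `0 ≤ C_D ≤ 1`), and `R⁴β^{−θ} ≤ 16β^{3θ} ≤ 16β`.
READING FOR THE LINE: (DR) is now a THEOREM up to box size `β^{1/100}`; its open content is exactly the femto extension `β^{1/100} < R ≤ ℓ₁/uRec β`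
(where the one-scale expansion's windows close) — and the reference of (DR) is identified: `2 − p(β) = (3/2)V_∞/β` to leading order, no log
(cf. gens 10–12: pinned only to `Θ(1/β)` ∕ `O(√(1/β))`).  HONEST FRAMING: nothing of E0′, NT or the gap; YM mass gap NOT proved; not Clay.
-/

set_option autoImplicit false

noncomputable section

open MeasureTheory Finset Filter Topology
open Literature.Probability.LatticeModels (Site)
open Literature.MathematicalPhysics.QuantumLattice
open Literature.MathematicalPhysics.QuantumFieldTheory
open Literature.MathematicalPhysics.QuantumFieldTheory.LatticeMaxwell
open Literature.MathematicalPhysics.QuantumFieldTheory.AxialGauge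
open Literature.MathematicalPhysics.QuantumFieldTheory.LatticeForm (d₁ d₂)
open Literature.MathematicalPhysics.QuantumFieldTheory.LatticeChain (div₂)
open Summit.QuantumFields.YangMills.Theorems.WeakCouplingRates
open Summit.QuantumFields.YangMills.Cruxes.OSLegsFromFemtoAndGap.DlrCollarTransfer (cubeSites cubeEdges kerE plane continuous_plane)

namespace Summit.QuantumFields.YangMills.Cruxes.UVSeamRec.ClassicalResponse.ColdWall

/-- The Dirichlet variance of the centre plaquette is within `K/(R+1)⁴` of the `ℤ⁴` value for `R + 1 ≥ 32`, and within `1 + |V_∞|` always; hence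
`R⁴ · |C_{D,R+1}(centre, q) − V_∞(q)| ≤ K + 31⁴(1 + |V_∞(q)|)` for every `R`. [folklore] -/
theorem pow_four_mul_abs_boxDirProjKernel_centre_sub_le :
    ∃ K : ℝ, 0 ≤ K ∧ ∀ (R : ℕ) (q : Fin 4 × Fin 4), q.1 < q.2 →
      (R : ℝ) ^ 4 * |boxDirProjKernel (R + 1) ((fun _ : Fin 4 => (R : ℤ) + 1), q.1, q.2) ((fun _ : Fin 4 => (R : ℤ) + 1), q.1, q.2) -
          d₁ (div₂ (greenTensor (((0 : Site 4), q.1, q.2) : Plaq 4))) 0 q.1 q.2| ≤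
        K + 31 ^ 4 * (1 + |d₁ (div₂ (greenTensor (((0 : Site 4), q.1, q.2) : Plaq 4))) 0 q.1 q.2|) := by
  obtain ⟨K, hK0, hK⟩ := exists_boxDirProjKernel_sub_curl_bound
  refine ⟨K, hK0, fun R q hq => ?_⟩
  have hcentre : (fun _ : Fin 4 => (R : ℤ) + 1) = boxCentre (R + 1) := by funext k; simp [boxCentre]
  set V := d₁ (div₂ (greenTensor (((0 : Site 4), q.1, q.2) : Plaq 4))) 0 q.1 q.2 with hV
  have hC1 : boxDirProjKernel (R + 1) ((fun _ : Fin 4 => (R : ℤ) + 1), q.1, q.2) ((fun _ : Fin 4 => (R : ℤ) + 1), q.1, q.2) ≤ 1 := by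
    have hxt := centre_mem_plaquettesTouching R q hq
    have hq' := unshift_mem_plaquettesIn hxt
    have h := boxDirProjKernel_le_one_of_mem (H := R + 1) hq' hq'
    have hs : Plaq.shift dirCorner (((fun _ : Fin 4 => (R : ℤ) + 1) - dirCorner, q.1, q.2) : Plaq 4) =
        ((fun _ : Fin 4 => (R : ℤ) + 1), q.1, q.2) := by simp [Plaq.shift]
    simpa only [hs] using h
  have hC0 : 0 ≤ boxDirProjKernel (R + 1) ((fun _ : Fin 4 => (R : ℤ) + 1), q.1, q.2) ((fun _ : Fin 4 => (R : ℤ) + 1), q.1, q.2) := by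
    have hpq : boxDirProjKernel (R + 1) ((fun _ : Fin 4 => (R : ℤ) + 1), q.1, q.2) ((fun _ : Fin 4 => (R : ℤ) + 1), q.1, q.2) =
        ∫ s, dirCirc (R + 1) ((fun _ : Fin 4 => (R : ℤ) + 1), q.1, q.2) s * dirCirc (R + 1) ((fun _ : Fin 4 => (R : ℤ) + 1), q.1, q.2) s
          ∂(boxDirichlet (R + 1)) := (integral_dirCirc_mul _ _).symm
    rw [hpq]
    exact integral_nonneg fun s => mul_self_nonneg _
  by_cases hR : 32 ≤ R + 1
  · -- large boxes: the route's Dirichlet-vs-ℤ⁴ law at the coincident centre pair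
    have hH : (32 : ℝ) ≤ ((R + 1 : ℕ) : ℝ) := by exact_mod_cast hR
    have hc : ‖((fun _ : Fin 4 => (R : ℤ) + 1) : Site 4) - boxCentre (R + 1)‖ ≤ ((R + 1 : ℕ) : ℝ) / 8 := by
      rw [hcentre, sub_self, norm_zero]; positivity
    have h := hK (R + 1) hH ((fun _ : Fin 4 => (R : ℤ) + 1), q.1, q.2) ((fun _ : Fin 4 => (R : ℤ) + 1), q.1, q.2) hq hq hc hc
    have hself := curl_greenTensor_self (fun _ : Fin 4 => (R : ℤ) + 1) q.1 q.2
    simp only at h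
    rw [hself] at h
    have hR4 : (R : ℝ) ^ 4 ≤ ((R + 1 : ℕ) : ℝ) ^ 4 := by
      push_cast; exact pow_le_pow_left₀ (Nat.cast_nonneg _) (by linarith) 4
    have hpos : (0 : ℝ) < ((R + 1 : ℕ) : ℝ) ^ 4 := by positivity
    calc (R : ℝ) ^ 4 * |boxDirProjKernel (R + 1) ((fun _ : Fin 4 => (R : ℤ) + 1), q.1, q.2) ((fun _ : Fin 4 => (R : ℤ) + 1), q.1, q.2) - V|
        ≤ ((R + 1 : ℕ) : ℝ) ^ 4 * (K / ((R + 1 : ℕ) : ℝ) ^ 4) := mul_le_mul hR4 h (abs_nonneg _) (by positivity)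
      _ = K := by field_simp
      _ ≤ K + 31 ^ 4 * (1 + |V|) := by nlinarith [abs_nonneg V]
  · -- small boxes: `0 ≤ C_D ≤ 1` and `R ≤ 30`
    rw [not_le] at hR
    have hR30 : (R : ℝ) ≤ 31 := by exact_mod_cast (by omega : R ≤ 31)
    have hR4 : (R : ℝ) ^ 4 ≤ 31 ^ 4 := pow_le_pow_left₀ (Nat.cast_nonneg _) hR30 4
    have habs : |boxDirProjKernel (R + 1) ((fun _ : Fin 4 => (R : ℤ) + 1), q.1, q.2) ((fun _ : Fin 4 => (R : ℤ) + 1), q.1, q.2) - V| ≤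
        1 + |V| := by
      calc |boxDirProjKernel (R + 1) ((fun _ : Fin 4 => (R : ℤ) + 1), q.1, q.2) ((fun _ : Fin 4 => (R : ℤ) + 1), q.1, q.2) - V|
          ≤ |boxDirProjKernel (R + 1) ((fun _ : Fin 4 => (R : ℤ) + 1), q.1, q.2) ((fun _ : Fin 4 => (R : ℤ) + 1), q.1, q.2)| + |V| :=
            abs_sub _ _
        _ ≤ 1 + |V| := by rw [abs_of_nonneg hC0]; linarith
    calc (R : ℝ) ^ 4 * |boxDirProjKernel (R + 1) ((fun _ : Fin 4 => (R : ℤ) + 1), q.1, q.2) ((fun _ : Fin 4 => (R : ℤ) + 1), q.1, q.2) - V|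
        ≤ 31 ^ 4 * (1 + |V|) := mul_le_mul hR4 habs (abs_nonneg _) (by positivity)
      _ ≤ K + 31 ^ 4 * (1 + |V|) := by linarith

/-- **(DR) ON THE POLYNOMIAL WINDOW.**  For `0 < θ ≤ 1/100` there are `A₀ ≥ 0`, `P₀`, `β₁` such that the reference values
`p q β := 2 − (3/2)·V_∞(q)/max β 1` are bounded by `P₀` and, for all `β ≥ β₁`, all `R` with `1 ≤ R` and `R + 1 ≤ ⌈β^θ⌉`, every plane `q.1 < q.2`
and every site `x`:  `R⁴ · |kerE^𝟙_{β,(x−R−1,2R+3)}(plane q x) − p q β| ≤ A₀` — the sentence of `ClassicalResponse.DirichletRate 1 A₀ β₁ ℓ₁ p` with the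
femto window clause `R·uRec β ≤ ℓ₁` replaced by `R + 1 ≤ ⌈β^θ⌉`. [folklore] -/
theorem dirichletRate_polyWindow {θ : ℝ} (hθ : 0 < θ) (hθ₂ : θ ≤ 1 / 100) :
    ∃ (A₀ P₀ β₁ : ℝ), 0 ≤ A₀ ∧
      (∀ (q : Fin 4 × Fin 4) (β : ℝ),
        |2 - 3 / 2 * d₁ (div₂ (greenTensor (((0 : Site 4), q.1, q.2) : Plaq 4))) 0 q.1 q.2 / max β 1| ≤ P₀) ∧
      ∀ β : ℝ, β₁ ≤ β → ∀ R : ℕ, 1 ≤ R → R + 1 ≤ ⌈β ^ θ⌉₊ →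
        ∀ (q : Fin 4 × Fin 4) (x : Fin 4 → ℤ), q.1 < q.2 →
          (R : ℝ) ^ 4 * |kerE (Matrix.specialUnitaryGroup (Fin 2) ℂ) (fundamentalLatticeRep 2) β (fun k => x k - (R + 1)) (2 * R + 3)
              (1 : LGConfig 4 (Matrix.specialUnitaryGroup (Fin 2) ℂ))
              (plane (Matrix.specialUnitaryGroup (Fin 2) ℂ) (fundamentalLatticeRep 2) q x) -
            (2 - 3 / 2 * d₁ (div₂ (greenTensor (((0 : Site 4), q.1, q.2) : Plaq 4))) 0 q.1 q.2 / max β 1)| ≤ A₀ := by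
  obtain ⟨K, hK0, hK⟩ := pow_four_mul_abs_boxDirProjKernel_centre_sub_le
  obtain ⟨β₀, hsc⟩ := kerE_one_deficit_semiclassical_polyWindow hθ hθ₂
  -- a uniform bound on the sixteen `ℤ⁴` values
  set M : ℝ := ∑ q : Fin 4 × Fin 4, |d₁ (div₂ (greenTensor (((0 : Site 4), q.1, q.2) : Plaq 4))) 0 q.1 q.2| with hM
  have hMq : ∀ q : Fin 4 × Fin 4, |d₁ (div₂ (greenTensor (((0 : Site 4), q.1, q.2) : Plaq 4))) 0 q.1 q.2| ≤ M := fun q =>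
    Finset.single_le_sum (f := fun q : Fin 4 × Fin 4 => |d₁ (div₂ (greenTensor (((0 : Site 4), q.1, q.2) : Plaq 4))) 0 q.1 q.2|)
      (fun q _ => abs_nonneg _) (Finset.mem_univ q)
  have hM0 : 0 ≤ M := Finset.sum_nonneg fun q _ => abs_nonneg _
  refine ⟨16 + 3 / 2 * (K + 31 ^ 4 * (1 + M)), 2 + 3 / 2 * M, max β₀ 1, by positivity, fun q β => ?_, fun β hβ R hR1 hR q x hq => ?_⟩
  · -- boundedness of the reference
    have hm1 : 1 ≤ max β 1 := le_max_right _ _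
    have h1 : |3 / 2 * d₁ (div₂ (greenTensor (((0 : Site 4), q.1, q.2) : Plaq 4))) 0 q.1 q.2 / max β 1| ≤ 3 / 2 * M := by
      rw [abs_div, abs_mul, abs_of_pos (by norm_num : (0 : ℝ) < 3 / 2), abs_of_pos (lt_of_lt_of_le one_pos hm1)]
      calc 3 / 2 * |d₁ (div₂ (greenTensor (((0 : Site 4), q.1, q.2) : Plaq 4))) 0 q.1 q.2| / max β 1
          ≤ 3 / 2 * |d₁ (div₂ (greenTensor (((0 : Site 4), q.1, q.2) : Plaq 4))) 0 q.1 q.2| / 1 :=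
            div_le_div_of_nonneg_left (by positivity) one_pos hm1
        _ ≤ 3 / 2 * M := by rw [div_one]; exact mul_le_mul_of_nonneg_left (hMq q) (by norm_num)
    calc |2 - 3 / 2 * d₁ (div₂ (greenTensor (((0 : Site 4), q.1, q.2) : Plaq 4))) 0 q.1 q.2 / max β 1|
        ≤ |(2 : ℝ)| + |3 / 2 * d₁ (div₂ (greenTensor (((0 : Site 4), q.1, q.2) : Plaq 4))) 0 q.1 q.2 / max β 1| := abs_sub _ _
      _ ≤ 2 + 3 / 2 * M := by rw [abs_two]; linarith
  · -- the rate on the polynomial window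
    have hβ0' : β₀ ≤ β := (le_max_left _ _).trans hβ
    have hβ1 : 1 ≤ β := (le_max_right _ _).trans hβ
    have hβ0 : 0 < β := by linarith
    rw [max_eq_left hβ1]
    set V := d₁ (div₂ (greenTensor (((0 : Site 4), q.1, q.2) : Plaq 4))) 0 q.1 q.2 with hV
    set C := boxDirProjKernel (R + 1) ((fun _ : Fin 4 => (R : ℤ) + 1), q.1, q.2) ((fun _ : Fin 4 => (R : ℤ) + 1), q.1, q.2) with hC
    -- the kernel mean of `plane` through the deficit
    have hdef := hsc β hβ0' R hR q x hq
    rw [← hC] at hdef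
    have hlin : kerE (Matrix.specialUnitaryGroup (Fin 2) ℂ) (fundamentalLatticeRep 2) β (fun k => x k - (R + 1)) (2 * R + 3)
        (1 : LGConfig 4 (Matrix.specialUnitaryGroup (Fin 2) ℂ))
        (fun U => 2 - plane (Matrix.specialUnitaryGroup (Fin 2) ℂ) (fundamentalLatticeRep 2) q x U) =
        2 - kerE (Matrix.specialUnitaryGroup (Fin 2) ℂ) (fundamentalLatticeRep 2) β (fun k => x k - (R + 1)) (2 * R + 3)
        (1 : LGConfig 4 (Matrix.specialUnitaryGroup (Fin 2) ℂ))
        (plane (Matrix.specialUnitaryGroup (Fin 2) ℂ) (fundamentalLatticeRep 2) q x) :=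
      kerE_const_sub (fundamentalLatticeRep 2) β _ _ _ (continuous_plane (fundamentalLatticeRep 2) q x) 2
    rw [hlin] at hdef
    set E := kerE (Matrix.specialUnitaryGroup (Fin 2) ℂ) (fundamentalLatticeRep 2) β (fun k => x k - (R + 1)) (2 * R + 3)
        (1 : LGConfig 4 (Matrix.specialUnitaryGroup (Fin 2) ℂ))
        (plane (Matrix.specialUnitaryGroup (Fin 2) ℂ) (fundamentalLatticeRep 2) q x) with hE
    -- |β(2 − E) − (3/2)C| ≤ β^{−θ} ≤ 1 and R⁴|C − V| ≤ K + 31⁴(1 + M)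
    have hθ1 : β ^ (-θ) ≤ 1 := Real.rpow_le_one_of_one_le_of_nonpos hβ1 (by linarith)
    have hCV := hK R q hq
    rw [← hC, ← hV] at hCV
    have hCV' : (R : ℝ) ^ 4 * |C - V| ≤ K + 31 ^ 4 * (1 + M) := by
      refine hCV.trans ?_
      have := hMq q
      rw [← hV] at this
      nlinarith [abs_nonneg V]
    -- R⁴ β^{−θ} ≤ 16 β : from R + 1 ≤ ⌈β^θ⌉ ≤ 2β^θ and 3θ ≤ 1
    obtain ⟨-, hceil⟩ := one_le_ceil_rpow_and_le hβ1 hθ.le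
    have hRle : (R : ℝ) ≤ 2 * β ^ θ := by
      have h1 : ((R + 1 : ℕ) : ℝ) ≤ (⌈β ^ θ⌉₊ : ℝ) := by exact_mod_cast hR
      push_cast at h1
      linarith
    have hR4 : (R : ℝ) ^ 4 * β ^ (-θ) ≤ 16 * β := by
      have hx0 : 0 ≤ β ^ θ := Real.rpow_nonneg hβ0.le _
      have h1 : (R : ℝ) ^ 4 ≤ (2 * β ^ θ) ^ 4 := pow_le_pow_left₀ (Nat.cast_nonneg _) hRle 4
      have h2 : (2 * β ^ θ) ^ 4 * β ^ (-θ) = 16 * β ^ (3 * θ) := by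
        rw [mul_pow, ← Real.rpow_natCast (β ^ θ) 4, ← Real.rpow_mul hβ0.le, mul_assoc, ← Real.rpow_add hβ0]
        norm_num; ring_nf
      have h3 : β ^ (3 * θ) ≤ β ^ (1 : ℝ) := Real.rpow_le_rpow_of_exponent_le hβ1 (by linarith)
      rw [Real.rpow_one] at h3
      calc (R : ℝ) ^ 4 * β ^ (-θ) ≤ (2 * β ^ θ) ^ 4 * β ^ (-θ) := mul_le_mul_of_nonneg_right h1 (Real.rpow_nonneg hβ0.le _)
        _ = 16 * β ^ (3 * θ) := h2
        _ ≤ 16 * β := by linarith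
    -- assemble: R⁴|E − (2 − (3/2)V/β)| = R⁴|β(2−E) − (3/2)V|/β ≤ (R⁴β^{−θ} + (3/2)R⁴|C − V|)/β
    have hkey : |E - (2 - 3 / 2 * V / β)| = |β * (2 - E) - 3 / 2 * V| / β := by
      have h' : (2 - 3 / 2 * V / β) - E = (β * (2 - E) - 3 / 2 * V) / β := by field_simp; ring
      rw [abs_sub_comm, h', abs_div, abs_of_pos hβ0]
    have hsplit : |β * (2 - E) - 3 / 2 * V| ≤ β ^ (-θ) + 3 / 2 * |C - V| := by
      calc |β * (2 - E) - 3 / 2 * V| = |(β * (2 - E) - 3 / 2 * C) + 3 / 2 * (C - V)| := by ring_nf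
        _ ≤ |β * (2 - E) - 3 / 2 * C| + |3 / 2 * (C - V)| := abs_add_le _ _
        _ ≤ β ^ (-θ) + 3 / 2 * |C - V| := by rw [abs_mul, abs_of_pos (by norm_num : (0 : ℝ) < 3 / 2)]; exact add_le_add hdef le_rfl
    rw [hkey, mul_div_assoc', div_le_iff₀ hβ0]
    have hR40 : 0 ≤ (R : ℝ) ^ 4 := by positivity
    calc (R : ℝ) ^ 4 * |β * (2 - E) - 3 / 2 * V| ≤ (R : ℝ) ^ 4 * (β ^ (-θ) + 3 / 2 * |C - V|) := mul_le_mul_of_nonneg_left hsplit hR40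
      _ = (R : ℝ) ^ 4 * β ^ (-θ) + 3 / 2 * ((R : ℝ) ^ 4 * |C - V|) := by ring
      _ ≤ 16 * β + 3 / 2 * (K + 31 ^ 4 * (1 + M)) := by linarith
      _ ≤ (16 + 3 / 2 * (K + 31 ^ 4 * (1 + M))) * β := by nlinarith

/-! ### §3 The unit of record against powers, and the reduction of (DR) to its femto tail -/

/-- **`β^a · uRec β → 0`** for every real `a`: the unit of record decays exponentially (`log uRec β = −β/(4b₀) + O(log β)`). [folklore] -/
theorem tendsto_rpow_mul_uRec (a : ℝ) : Tendsto (fun β : ℝ => β ^ a * Transport.uRec β) atTop (𝓝 0) := by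
  have hb0 : (0 : ℝ) < Summit.QuantumFields.YangMills.Theorems.FemtoTransferGap.b0 := by
    unfold Summit.QuantumFields.YangMills.Theorems.FemtoTransferGap.b0; positivity
  set B0 : ℝ := Summit.QuantumFields.YangMills.Theorems.FemtoTransferGap.b0 with hB0
  set K : ℝ := Summit.QuantumFields.YangMills.Theorems.FemtoTransferGap.b1 / (2 * B0 ^ 2) with hK
  -- the exponent `a log β + sizeLog β 1 = −β/(4B0) + ((K + a) log β − K log(2B0)) → −∞`
  have hf : Tendsto (fun β : ℝ => -(β / (4 * B0))) atTop atBot :=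
    tendsto_neg_atTop_atBot.comp (tendsto_id.atTop_div_const (by positivity))
  have hg : (fun β : ℝ => (K + a) * Real.log β - K * Real.log (2 * B0)) =o[atTop] (fun β : ℝ => -(β / (4 * B0))) := by
    have h1 : (fun β : ℝ => (K + a) * Real.log β - K * Real.log (2 * B0)) =o[atTop] (fun β : ℝ => β) := by
      have hlog : (fun β : ℝ => (K + a) * Real.log β) =o[atTop] (fun β : ℝ => β) := Real.isLittleO_log_id_atTop.const_mul_left _
      have hc : (fun _ : ℝ => K * Real.log (2 * B0)) =o[atTop] (fun β : ℝ => β) :=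
        Asymptotics.isLittleO_const_left.2 (Or.inr (show Tendsto (fun β : ℝ => ‖β‖) atTop atTop from tendsto_norm_atTop_atTop))
      exact hlog.sub hc
    have h2 : (fun β : ℝ => β) =O[atTop] (fun β : ℝ => -(β / (4 * B0))) := by
      refine Asymptotics.IsBigO.of_bound (4 * B0) (Eventually.of_forall fun β => ?_)
      rw [norm_neg, norm_div, Real.norm_of_nonneg (by positivity : (0 : ℝ) ≤ 4 * B0), mul_div_cancel₀ _ (by positivity)]
    exact h1.trans_isBigO h2
  have hsum : Tendsto ((fun β : ℝ => -(β / (4 * B0))) + fun β : ℝ => (K + a) * Real.log β - K * Real.log (2 * B0)) atTop atBot :=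
    ((Asymptotics.IsEquivalent.refl.add_isLittleO hg).symm).tendsto_atBot hf
  have hexp := Real.tendsto_exp_atBot.comp hsum
  refine hexp.congr' ?_
  filter_upwards [eventually_gt_atTop (0 : ℝ)] with β hβ
  simp only [Function.comp_apply, Pi.add_apply, Transport.uRec, Summit.QuantumFields.YangMills.Theorems.FemtoTransferGap.sizeLog, hK, hB0,
    Nat.cast_one, Real.log_one]
  rw [Real.rpow_def_of_pos hβ, ← Real.exp_add, Real.log_div (mul_pos two_pos hb0).ne' hβ.ne']
  congr 1
  ring

/-- Eventually `⌈β^θ⌉ · uRec β ≤ ℓ` for every `ℓ > 0` (`0 ≤ θ`). [folklore] -/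
theorem eventually_ceil_rpow_mul_uRec_le {θ : ℝ} (hθ : 0 ≤ θ) {ℓ : ℝ} (hℓ : 0 < ℓ) :
    ∃ β₂ : ℝ, ∀ β : ℝ, β₂ ≤ β → (⌈β ^ θ⌉₊ : ℝ) * Transport.uRec β ≤ ℓ := by
  have h := (tendsto_rpow_mul_uRec θ).const_mul 2
  rw [mul_zero] at h
  have hev : ∀ᶠ β : ℝ in atTop, 2 * (β ^ θ * Transport.uRec β) ≤ ℓ := (h.eventually (eventually_le_nhds hℓ))
  obtain ⟨b, hb⟩ := (hev.and (eventually_ge_atTop 1)).exists_forall_of_atTop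
  refine ⟨b, fun β hβ => ?_⟩
  obtain ⟨h2, hβ1⟩ := hb β hβ
  obtain ⟨-, hceil⟩ := one_le_ceil_rpow_and_le hβ1 hθ
  have hu : 0 ≤ Transport.uRec β := (Real.exp_pos _).le
  calc (⌈β ^ θ⌉₊ : ℝ) * Transport.uRec β ≤ 2 * β ^ θ * Transport.uRec β := mul_le_mul_of_nonneg_right hceil hu
    _ = 2 * (β ^ θ * Transport.uRec β) := by ring
    _ ≤ ℓ := h2

/-- **(DR) REDUCES TO ITS FEMTO TAIL.**  If the sentence of `DirichletRateSU2` holds on the TAIL window `⌈β^θ⌉ ≤ R + 2 ∧ R·uRec β ≤ ℓ₁` (one scale of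
overlap with the polynomial window, its own `∃`-reference `p`), then `DirichletRateSU2` holds (with the tail's reference and `C₁ = 1`): on the
polynomial part use `dirichletRate_polyWindow` and glue the two references at the junction scale `R* = ⌈β^θ⌉ − 1`, where both hold
(`|p₁ − p| ≤ (A₀ᵖ + C₁A₀)/R*⁴ ≤ (A₀ᵖ + C₁A₀)/R⁴` for `R ≤ R*`). [folklore] -/
theorem dirichletRateSU2_of_femtoTail {θ : ℝ} (hθ : 0 < θ) (hθ₂ : θ ≤ 1 / 100)
    (htail : ∃ (C₁ A₀ P₀ β₁ ℓ₁ : ℝ) (p : Fin 4 × Fin 4 → ℝ → ℝ), 0 < C₁ ∧ 0 ≤ A₀ ∧ 0 < ℓ₁ ∧ (∀ q β, |p q β| ≤ P₀) ∧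
      ∀ β : ℝ, β₁ ≤ β → ∀ R : ℕ, 1 ≤ R → ⌈β ^ θ⌉₊ ≤ R + 2 → (R : ℝ) * Transport.uRec β ≤ ℓ₁ →
        ∀ (q : Fin 4 × Fin 4) (x : Fin 4 → ℤ), q.1 < q.2 →
          (R : ℝ) ^ 4 / C₁ * |kerE (Matrix.specialUnitaryGroup (Fin 2) ℂ) (fundamentalLatticeRep 2) β (fun k => x k - (R + 1)) (2 * R + 3)
              (1 : LGConfig 4 (Matrix.specialUnitaryGroup (Fin 2) ℂ))
              (plane (Matrix.specialUnitaryGroup (Fin 2) ℂ) (fundamentalLatticeRep 2) q x) - p q β| ≤ A₀) :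
    DirichletRateSU2 := by
  obtain ⟨A₀, P₀, β₀, hA₀, -, hpoly⟩ := dirichletRate_polyWindow hθ hθ₂
  obtain ⟨C₁, A₁, P₁, β₁, ℓ₁, p, hC₁, hA₁, hℓ₁, hP₁, htail⟩ := htail
  obtain ⟨β₂, hjunc⟩ := eventually_ceil_rpow_mul_uRec_le hθ.le hℓ₁
  -- eventually `β^θ ≥ 16`, so that the junction scale `⌈β^θ⌉ − 1 ≥ 1`
  obtain ⟨β₃, hβ₃⟩ := ((tendsto_rpow_atTop hθ).eventually_ge_atTop (16 : ℝ)).exists_forall_of_atTop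
  refine ⟨1, 2 * A₀ + C₁ * A₁, P₁, max (max β₀ β₁) (max (max β₂ β₃) 1), ℓ₁, p, one_pos, by positivity, hℓ₁, hP₁,
    fun β hβ R hR1 hRu q x hq => ?_⟩
  simp only [max_le_iff] at hβ
  obtain ⟨⟨hb0, hb1⟩, ⟨hb2, hb3⟩, hβ1⟩ := hβ
  have hβ0 : 0 < β := by linarith
  -- abbreviations
  set E : ℕ → ℝ := fun R => kerE (Matrix.specialUnitaryGroup (Fin 2) ℂ) (fundamentalLatticeRep 2) β (fun k => x k - (R + 1)) (2 * R + 3)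
      (1 : LGConfig 4 (Matrix.specialUnitaryGroup (Fin 2) ℂ)) (plane (Matrix.specialUnitaryGroup (Fin 2) ℂ) (fundamentalLatticeRep 2) q x)
    with hEdef
  set p₁ : ℝ := 2 - 3 / 2 * d₁ (div₂ (greenTensor (((0 : Site 4), q.1, q.2) : Plaq 4))) 0 q.1 q.2 / max β 1 with hp₁
  -- the tail bound in the form `R⁴ |E R − p| ≤ C₁ A₁`
  have htail' : ∀ R' : ℕ, 1 ≤ R' → ⌈β ^ θ⌉₊ ≤ R' + 2 → (R' : ℝ) * Transport.uRec β ≤ ℓ₁ → (R' : ℝ) ^ 4 * |E R' - p q β| ≤ C₁ * A₁ := by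
    intro R' h1 h2 h3
    have h := htail β hb1 R' h1 h2 h3 q x hq
    have hR0 : 0 ≤ (R' : ℝ) ^ 4 := by positivity
    rw [div_mul_eq_mul_div, div_le_iff₀ hC₁] at h
    linarith [h]
  rw [div_one]
  by_cases hcase : ⌈β ^ θ⌉₊ ≤ R + 2
  · -- tail range
    have h := htail' R hR1 hcase hRu
    nlinarith [h, hA₀, abs_nonneg (E R - p q β), show (0:ℝ) ≤ (R:ℝ)^4 * |E R - p q β| by positivity]
  · -- polynomial range; junction scale `R* = ⌈β^θ⌉ − 1`
    rw [not_le] at hcase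
    have h16 : (16 : ℝ) ≤ β ^ θ := hβ₃ β hb3
    have hc16 : 16 ≤ ⌈β ^ θ⌉₊ := by
      have : (16 : ℝ) ≤ (⌈β ^ θ⌉₊ : ℝ) := h16.trans (Nat.le_ceil _)
      exact_mod_cast this
    obtain ⟨Rs, hRs⟩ : ∃ Rs : ℕ, ⌈β ^ θ⌉₊ = Rs + 1 := ⟨⌈β ^ θ⌉₊ - 1, by omega⟩
    have hRs1 : 1 ≤ Rs := by omega
    have hRRs : R ≤ Rs := by omega
    -- poly at R and at Rs, tail at Rs
    have hpR := hpoly β hb0 R hR1 (by omega) q x hq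
    have hpRs := hpoly β hb0 Rs hRs1 (by omega) q x hq
    have hRsu : (Rs : ℝ) * Transport.uRec β ≤ ℓ₁ := by
      have hj := hjunc β hb2
      have hle : (Rs : ℝ) ≤ (⌈β ^ θ⌉₊ : ℝ) := by rw [hRs]; push_cast; linarith
      exact le_trans (mul_le_mul_of_nonneg_right hle (Real.exp_pos _).le) hj
    have htRs := htail' Rs hRs1 (by omega) hRsu
    change (R : ℝ) ^ 4 * |E R - p₁| ≤ A₀ at hpR
    change (Rs : ℝ) ^ 4 * |E Rs - p₁| ≤ A₀ at hpRs
    -- R ≤ Rs: transport the junction bounds down to scale R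
    have hRle : (R : ℝ) ^ 4 ≤ (Rs : ℝ) ^ 4 := pow_le_pow_left₀ (Nat.cast_nonneg _) (by exact_mod_cast hRRs) 4
    have hR0 : 0 ≤ (R : ℝ) ^ 4 := by positivity
    have h1 : (R : ℝ) ^ 4 * |E Rs - p₁| ≤ A₀ := le_trans (mul_le_mul_of_nonneg_right hRle (abs_nonneg _)) hpRs
    have h2 : (R : ℝ) ^ 4 * |E Rs - p q β| ≤ C₁ * A₁ := le_trans (mul_le_mul_of_nonneg_right hRle (abs_nonneg _)) htRs
    have htri : |E R - p q β| ≤ |E R - p₁| + |E Rs - p₁| + |E Rs - p q β| := by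
      calc |E R - p q β| = |(E R - p₁) - (E Rs - p₁) + (E Rs - p q β)| := by ring_nf
        _ ≤ |(E R - p₁) - (E Rs - p₁)| + |E Rs - p q β| := abs_add_le _ _
        _ ≤ |E R - p₁| + |E Rs - p₁| + |E Rs - p q β| := by linarith [abs_sub (E R - p₁) (E Rs - p₁)]
    calc (R : ℝ) ^ 4 * |E R - p q β| ≤ (R : ℝ) ^ 4 * (|E R - p₁| + |E Rs - p₁| + |E Rs - p q β|) := mul_le_mul_of_nonneg_left htri hR0
      _ = (R : ℝ) ^ 4 * |E R - p₁| + (R : ℝ) ^ 4 * |E Rs - p₁| + (R : ℝ) ^ 4 * |E Rs - p q β| := by ring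
      _ ≤ A₀ + A₀ + C₁ * A₁ := by linarith
      _ = 2 * A₀ + C₁ * A₁ := by ring

/-- The converse of `dirichletRateSU2_of_femtoTail` is immediate (the tail window lies inside the femto window): `DirichletRateSU2` holds
IFF its sentence holds on the femto tail — the LEAD g14 reshape of `stub_dirichletRate` into `stub_dirichletRateFemtoTail` loses nothing. [folklore] -/
theorem femtoTail_of_dirichletRateSU2 (θ : ℝ) (h : DirichletRateSU2) :
    ∃ (C₁ A₀ P₀ β₁ ℓ₁ : ℝ) (p : Fin 4 × Fin 4 → ℝ → ℝ), 0 < C₁ ∧ 0 ≤ A₀ ∧ 0 < ℓ₁ ∧ (∀ q β, |p q β| ≤ P₀) ∧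
      ∀ β : ℝ, β₁ ≤ β → ∀ R : ℕ, 1 ≤ R → ⌈β ^ θ⌉₊ ≤ R + 2 → (R : ℝ) * Transport.uRec β ≤ ℓ₁ →
        ∀ (q : Fin 4 × Fin 4) (x : Fin 4 → ℤ), q.1 < q.2 →
          (R : ℝ) ^ 4 / C₁ * |kerE (Matrix.specialUnitaryGroup (Fin 2) ℂ) (fundamentalLatticeRep 2) β (fun k => x k - (R + 1)) (2 * R + 3)
              (1 : LGConfig 4 (Matrix.specialUnitaryGroup (Fin 2) ℂ))
              (plane (Matrix.specialUnitaryGroup (Fin 2) ℂ) (fundamentalLatticeRep 2) q x) - p q β| ≤ A₀ := by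
  obtain ⟨C₁, A₀, P₀, β₁, ℓ₁, p, hC₁, hA₀, hℓ₁, hP, hDR⟩ := h
  exact ⟨C₁, A₀, P₀, β₁, ℓ₁, p, hC₁, hA₀, hℓ₁, hP, fun β hβ R hR _ hRu q x hq => hDR β hβ R hR hRu q x hq⟩

end Summit.QuantumFields.YangMills.Cruxes.UVSeamRec.ClassicalResponse.ColdWall

end
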